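import Summits.BirchSwinnertonDyer.BirchSwinnertonDyer.Theorems.EdixhovenFibreFiveSevenTwistDegreeStepFiveSevenLTwistCore
import Literature.NumberTheory.EllipticCurves.NewformsTwistNewProofs
import Literature.NumberTheory.EllipticCurves.ModularityVersionApProofs
import Literature.NumberTheory.EllipticCurves.LFunctionSmulProofs
import Literature.NumberTheory.EllipticCurves.CuspFormLFunctionLevelConductorProofs
import Summits.BirchSwinnertonDyer.Rank1Residual.Additive.QuadraticTwistCoefficients
import Literature.NumberTheory.EllipticCurves.ModularCurveIharaLemmaSquare
import HarnessLib
/-!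
# L-TWIST from the THREE-COPY Ihara lemma: `Λ(f) ⊆ s·Λ(g) + p·Λ(f)` for the newform `g` of the unit twist
# (route `EdixhovenFibreFiveSeven`, crux TDS57 / KP57, `--supports`)

Cell `pub/bsd-wall` (D-0145 line `route-BirchSwinnertonDyer-EdixhovenFibreFiveSeven`), seat `bsd-line-edix-p2`
(prover). Route-free file: THEOREMS ONLY (no definition, no named fact, no `sorry`); it CONSUMES the cite-only
named fact `ModularForms.diamondRibet1997_iharaLemma_sq` (`Literature/…/ModularCurveIharaLemmaSquare`, the
three-copy `q²`-version of Ihara's lemma, Diamond–Ribet 1997 Lemma 4.6 / Darmon–Diamond–Taylor 1995 §4.5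
p. 137, typed by the sibling seat edix-p4 in the binder shape agreed on the cell bus). BSD is not proved by this
file and nothing is closed unconditionally.

* §B the integral eigencharacter `θ_f : ℤ[T_r : r ∤ S] → ℤ` of a newform with integer coefficients
  (`exists_eigenHom`: `s·f = θ_f(s) f`, `θ_f(T_r) = a_r`; Diamond–Shurman Prop. 5.8.5).
* (input) the cite-only fact `diamondRibet1997_iharaLemma_sq` (three-copy Ihara: for `q ∤ M`, `M > 3`, a
  maximal non-Eisenstein `𝔫 ⊂ ℤ[T_r : r ∤ Mq²]` of odd residue characteristic `≠ q`, some `s ∉ 𝔫` multiplies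
  `H₁(X₀(M), ℤ)³` into the image of `(α_*, β_*, γ_*) : H₁(X₀(Mq²), ℤ) → H₁(X₀(M), ℤ)³`).
* §E **`lTwist_of_ihara3`** — GRANTED that fact and ONE prime `r ≡ 1 (mod N q²)` with
  `a_r(V₀) ≢ r + 1 (mod p)` (the non-Eisenstein witness; by Chebotarev it exists whenever `E[p]` is
  irreducible — Darmon–Diamond–Taylor Lemma 4.12 — left as a hypothesis): for `V₀/ℚ` globally minimal,
  ADDITIVE at `p ≥ 5`, `E[p]` irreducible, `D₀` a conductor-level datum with newform `f`, a prime `q ∤ 2pN(V₀)`,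
  `Vχ` a globally minimal model of `V₀ ⊗ χ_{q*}`, `s² = q*` and ANY newform `g` of `Vχ`:
  `Λ(f) ⊆ s·Λ(g) + p·Λ(f)`. Proof: `𝔫 = ker(θ_f mod p)` is maximal with `2, q ∉ 𝔫`, not Eisenstein by the
  witness; Ihara³ gives `s₀ ∉ 𝔫` lifting `(x, 0, 0)`; `lTwist_core` (sibling `…LTwistCore`); and `g` IS
  `f ⊗ χ_q` at level `N q²` (Atkin–Li, tree `isNewform0_charTwist_of_isPrimePow_of_coprime`;
  `aₙ(Vχ) = (n/q)·aₙ(V₀)`, tree `lFunction_quadraticTwist_apply_of_hasAdditiveReductionAt`; strong multiplicity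
  one across levels, tree `IsNewformOf.level_eq_level`).

So, with p589348: **TDS57 ⟸ F″ ∧ Ihara³ ∧ (non-Eisenstein witness)** — all three published inputs.

References: [DarmonDiamondTaylor1995] Lemma 4.28, Lemma 4.30, §4.5 pp. 135–137, Lemma 4.12 p. 120;
[Ribet1984ICM] Thm. 4.1; [AtkinLi1978] §3 Thm. 3.1; [DiamondShurman2005] Prop. 5.8.5, Thm. 8.8.1;
[Stevens1989] Lemma (5.4).
-/

set_option autoImplicit false
-- the Theorems directory repeats the summit name (sibling precedent `SignedBaseChangeAssembly.lean`)
set_option linter.dupNamespace false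

noncomputable section

open scoped MatrixGroups ModularForm NumberTheorySymbols

open CongruenceSubgroup UpperHalfPlane

namespace Summit.BirchSwinnertonDyer.BirchSwinnertonDyer.Theorems.LTwist

open Literature.NumberTheory.EllipticCurves.ModularForms Literature.NumberTheory.QuadraticFields

/-! ### §B The integral eigencharacter `θ_f : 𝕋̃ → ℤ` of a newform with integer coefficients -/

/-- Integer scalars acting on a non-zero form are determined by the action. [folklore] -/
theorem int_eq_of_smul_eq {M : ℕ} {k : ℤ} {f : CuspForm (Gamma0 M) k} (hf : f ≠ 0) {m n : ℤ}
    (h : ((m : ℂ)) • f = ((n : ℂ)) • f) : m = n := by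
  have : ((m : ℂ) - n) • f = 0 := by rw [sub_smul, h, sub_self]
  rcases smul_eq_zero.mp this with h0 | h0
  · exact_mod_cast sub_eq_zero.mp h0
  · exact absurd h0 hf

/-- **Every element of the prime-to-`S` Hecke ring acts on a newform `f` with INTEGER coefficients by an
integer scalar**: `s · f = θ_f(s) f`, `θ_f(s) ∈ ℤ` — on the generators `T_r f = a_r f`
(`IsNewform0.heckeT_eq_coeff_smul`, Diamond–Shurman Prop. 5.8.5) with `a_r ∈ ℤ`, and the set of such `s`
is a subring. [cite: DiamondShurman2005, Prop. 5.8.5] -/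
theorem exists_int_toEnd_eq_smul {M : ℕ} [NeZero M] (S : ℕ) {f : CuspForm (Gamma0 M) 2}
    (hf : IsNewform0 f) (a : ℕ → ℤ) (ha : ∀ n, cuspCoeff f n = (a n : ℂ))
    (s : HeckeRing0.primeTo M 2 S) :
    ∃ n : ℤ, HeckeRing0.toEnd M 2 (s : HeckeRing0 M 2) f = (n : ℂ) • f := by
  obtain ⟨s, hs⟩ := s
  show ∃ n : ℤ, HeckeRing0.toEnd M 2 s f = (n : ℂ) • f
  change s ∈ Algebra.adjoin ℤ _ at hs
  induction hs using Algebra.adjoin_induction with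
  | mem x hx =>
    obtain ⟨r, hr, -, rfl⟩ := hx
    haveI : NeZero r := ⟨hr.ne_zero⟩
    refine ⟨a r, ?_⟩
    rw [HeckeRing0.toEnd_T, hf.heckeT_eq_coeff_smul hr]
    change cuspCoeff f r • f = _
    rw [ha r]
  | algebraMap n =>
    refine ⟨n, ?_⟩
    rw [Algebra.algebraMap_eq_smul_one, map_zsmul, map_one, LinearMap.smul_apply,
      Module.End.one_apply, Int.cast_smul_eq_zsmul]
  | add x y _ _ hx hy =>
    obtain ⟨m, hm⟩ := hx
    obtain ⟨n, hn⟩ := hy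
    exact ⟨m + n, by rw [map_add, LinearMap.add_apply, hm, hn, Int.cast_add, add_smul]⟩
  | mul x y _ _ hx hy =>
    obtain ⟨m, hm⟩ := hx
    obtain ⟨n, hn⟩ := hy
    exact ⟨m * n, by rw [map_mul, Module.End.mul_apply, hn, LinearMap.map_smul, hm, smul_smul,
      Int.cast_mul, mul_comm]⟩

/-- **The integral eigencharacter `θ_f : 𝕋̃ → ℤ`** of a newform `f ∈ S₂(Γ₀(M))` with integer coefficients
`a_n`: a ring homomorphism on the prime-to-`S` Hecke ring `𝕋̃ = ℤ[T_r : r ∤ S]` with `s · f = θ_f(s) f` for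
all `s` and `θ_f(T_r) = a_r` (Darmon–Diamond–Taylor §4.1: the character `𝕋 → 𝒪` of an eigenform).
[cite: DarmonDiamondTaylor1995, §4.1 (p. 107)] -/
theorem exists_eigenHom {M : ℕ} [NeZero M] (S : ℕ) {f : CuspForm (Gamma0 M) 2}
    (hf : IsNewform0 f) (a : ℕ → ℤ) (ha : ∀ n, cuspCoeff f n = (a n : ℂ)) :
    ∃ θ : HeckeRing0.primeTo M 2 S →+* ℤ,
      (∀ s : HeckeRing0.primeTo M 2 S, HeckeRing0.toEnd M 2 (s : HeckeRing0 M 2) f = ((θ s : ℤ) : ℂ) • f) ∧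
      ∀ (r : ℕ) (hr : r.Prime) (hrS : ¬ r ∣ S), θ (HeckeRing0.primeTo.T M 2 S hr hrS) = a r := by
  classical
  -- a newform is non-zero (`a₁ = 1`; the tree's `BCDT.IsNewform0.ne_zero_of_isNormalized`, inlined)
  have hf0 : f ≠ 0 := by
    intro h
    have h1 : cuspCoeff f 1 = 1 := hf.2.2
    rw [h, cuspCoeff_zero_form (one_mem_strictPeriods_gamma0 M)] at h1
    exact zero_ne_one h1
  choose θ hθ using exists_int_toEnd_eq_smul S hf a ha
  have huniq : ∀ (s : HeckeRing0.primeTo M 2 S) (n : ℤ),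
      HeckeRing0.toEnd M 2 (s : HeckeRing0 M 2) f = (n : ℂ) • f → θ s = n :=
    fun s n h ↦ int_eq_of_smul_eq hf0 ((hθ s).symm.trans h)
  refine ⟨{ toFun := θ, map_one' := ?_, map_mul' := ?_, map_zero' := ?_, map_add' := ?_ }, ?_, ?_⟩
  · exact huniq 1 1 (by rw [OneMemClass.coe_one, map_one, Module.End.one_apply, Int.cast_one, one_smul])
  · intro x y
    refine huniq (x * y) _ ?_
    rw [Subalgebra.coe_mul, map_mul, Module.End.mul_apply, hθ y, LinearMap.map_smul, hθ x, smul_smul,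
      Int.cast_mul, mul_comm]
  · exact huniq 0 0 (by rw [ZeroMemClass.coe_zero, map_zero, LinearMap.zero_apply, Int.cast_zero,
      zero_smul])
  · intro x y
    refine huniq (x + y) _ ?_
    rw [AddMemClass.coe_add, map_add, LinearMap.add_apply, hθ x, hθ y, Int.cast_add, add_smul]
  · intro s
    exact hθ s
  · intro r hr hrS
    haveI : NeZero r := ⟨hr.ne_zero⟩
    refine huniq _ _ ?_
    rw [HeckeRing0.primeTo.coe_T, HeckeRing0.toEnd_T, hf.heckeT_eq_coeff_smul hr]
    change cuspCoeff f r • f = _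
    rw [ha r]

/-- **Hecke operators act on cycles through the eigencharacter when read against `f`**:
`(s · x)(f) = θ_f(s) · x(f)` for `x ∈ S₂^∨` (transposed action, `HeckeRing0.smul_dual_apply`).
[cite: DarmonDiamondTaylor1995, §1.6 (p. 41)] -/
theorem smul_dual_apply_eq_mul {M : ℕ} [NeZero M] {S : ℕ} {f : CuspForm (Gamma0 M) 2}
    {θ : HeckeRing0.primeTo M 2 S →+* ℤ}
    (hθ : ∀ s : HeckeRing0.primeTo M 2 S, HeckeRing0.toEnd M 2 (s : HeckeRing0 M 2) f = ((θ s : ℤ) : ℂ) • f)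
    (s : HeckeRing0.primeTo M 2 S) (x : Module.Dual ℂ (CuspForm (Gamma0 M) 2)) :
    ((s : HeckeRing0 M 2) • x) f = (θ s : ℂ) * x f := by
  rw [HeckeRing0.smul_dual_apply, hθ s, map_smul, smul_eq_mul]

/-! ### §E Assembly: L-TWIST from the three-copy Ihara lemma and the non-Eisenstein prime -/

/-- `q* = (−1)^{(q−1)/2} q ≡ 1 (mod 4)`, is square-free and has absolute value `q` (odd prime `q`). [folklore] -/
theorem pStar_facts {q : ℕ} (hq : q.Prime) (hq2 : q ≠ 2) :
    ((-1 : ℤ) ^ (q / 2) * q) % 4 = 1 ∧ Squarefree ((-1 : ℤ) ^ (q / 2) * q) ∧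
      (((-1 : ℤ) ^ (q / 2) * q).natAbs = q) := by
  have hodd : q % 2 = 1 := Nat.odd_iff.mp (hq.odd_of_ne_two hq2)
  have habs : ((-1 : ℤ) ^ (q / 2) * q).natAbs = q := by
    rw [Int.natAbs_mul, Int.natAbs_pow, Int.natAbs_neg, Int.natAbs_one, one_pow, one_mul,
      Int.natAbs_natCast]
  refine ⟨?_, ?_, habs⟩
  · rcases Nat.odd_mod_four_iff.mp hodd with h4 | h4
    · have he : Even (q / 2) := ⟨q / 4, by omega⟩
      rw [he.neg_one_pow, one_mul]; omega
    · have ho : Odd (q / 2) := ⟨q / 4, by omega⟩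
      rw [ho.neg_one_pow, neg_one_mul]; omega
  · rw [← Int.squarefree_natAbs, habs]
    exact hq.prime.squarefree

/-- **L-TWIST from the three-copy Ihara lemma and a non-Eisenstein witness prime.** GRANTED the cite-only
fact `diamondRibet1997_iharaLemma_sq` (Diamond–Ribet 1997 Lemma 4.6 / DDT 1995 §4.5 p. 137) and, for the curve at hand, ONE prime
`r ≡ 1 (mod N q²)` with `a_r(E) ≢ r + 1 (mod p)` (the non-Eisenstein witness; by Chebotarev it exists
whenever `E[p]` is irreducible — hypothesis `hNE`, per curve and auxiliary level), the twisted-period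
decomposition holds: for `V₀/ℚ` globally minimal, ADDITIVE at `p ≥ 5` (so `N(V₀) > 3`), `E[p]` irreducible,
`D₀` a conductor-level datum with newform `f`, `q ∤ 2 p N(V₀)` prime, `Vχ` a globally minimal model of
`V₀ ⊗ χ_{q*}`, `s² = q*`, and ANY newform `g` of `Vχ` (any level): **`Λ(f) ⊆ s·Λ(g) + p·Λ(f)`**.
Proof: `g = f ⊗ χ_q` at level `N q²` (Atkin–Li, tree `isNewform0_charTwist_of_isPrimePow_of_coprime`;
strong multiplicity one `IsNewformOf.level_eq_level`; `aₙ(Vχ) = (n/q) aₙ(V₀)`); the integral eigencharacter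
`θ_f` of the prime-to-`N q²` Hecke ring and `𝔫 = ker(θ_f mod p)` (maximal, `2, q ∉ 𝔫`, not Eisenstein by the
witness); Ihara³ gives `s₀ ∉ 𝔫` lifting `(x, 0, 0)`; then `lTwist_core`.
[cite: DarmonDiamondTaylor1995, §4.5 p. 137] [cite: Stevens1989, Lemma (5.4) p. 97] [cite: AtkinLi1978, §3, Thm. 3.1] -/
theorem lTwist_of_ihara3 (hI3 : diamondRibet1997_iharaLemma_sq)
    {p : ℕ} [Fact p.Prime] {q : ℕ} [Fact q.Prime] (V₀ : WeierstrassCurve ℚ) [V₀.IsElliptic]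
    [V₀.IsGloballyMinimal] [NeZero (V₀.conductorNorm ℤ)]
    (D₀ : ModularParametrizationData V₀ (V₀.conductorNorm ℤ)) (hp5 : 5 ≤ p)
    (hadd : Literature.NumberTheory.EllipticCurves.Rank1Residual.Addv V₀ p) (hq2 : q ≠ 2) (hqp : q ≠ p)
    (hqN : ¬ q ∣ V₀.conductorNorm ℤ)
    (hNE : ∃ r : ℕ, r.Prime ∧ ¬ r ∣ V₀.conductorNorm ℤ * q ^ 2 ∧ r ≡ 1 [MOD V₀.conductorNorm ℤ * q ^ 2] ∧
      ¬ (p : ℤ) ∣ V₀.LFunction r - (r + 1))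
    (Vχ : WeierstrassCurve ℚ) [Vχ.IsElliptic] [Vχ.IsGloballyMinimal] (v : WeierstrassCurve.VariableChange ℚ)
    (hv : v • V₀.quadraticTwist (((-1 : ℤ) ^ (q / 2) * q : ℤ) : ℚ) = Vχ)
    (s : ℂ) (hs2 : s ^ 2 = (((-1 : ℤ) ^ (q / 2) * q : ℤ) : ℂ))
    {N' : ℕ} [NeZero N'] (g : CuspForm (Gamma0 N') 2) (hg : IsNewformOf Vχ g) :
    ∀ z ∈ periodLattice D₀.f, ∃ w ∈ periodLattice g, ∃ y ∈ periodLattice D₀.f,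
      z = s * w + (p : ℂ) * y := by
  intro z hz
  have hpP : p.Prime := Fact.out
  have hqP : q.Prime := Fact.out
  haveI : NeZero q := ⟨hqP.ne_zero⟩
  set M := V₀.conductorNorm ℤ with hMdef
  set f := D₀.f with hfdef
  have hf : IsNewformOf V₀ f := D₀.isNewformOf
  set d : ℤ := (-1 : ℤ) ^ (q / 2) * q with hd
  obtain ⟨hd4, hdsq, hdabs⟩ := pStar_facts hqP hq2
  have hodd : Odd q := hqP.odd_of_ne_two hq2
  have hχ : (jacobiChar q).IsQuadratic := fun a ↦ jacobiChar_trichotomy a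
  have hprim : (jacobiChar q).IsPrimitive := isPrimitive_jacobiChar hodd hqP.squarefree
  -- `3 < M`: `p ∣ M` (additive at `p`)
  have hpM : p ∣ M := (V₀.dvd_conductorNorm_iff_not_hasGoodReductionAtPrime p).mpr hadd.1
  have hM3 : 3 < M := lt_of_lt_of_le (by omega) (Nat.le_of_dvd (Nat.pos_of_ne_zero (NeZero.ne M)) hpM)
  -- coefficient laws of `f`
  have ha : ∀ n, cuspCoeff f n = ((V₀.LFunction n : ℤ) : ℂ) := hf.2
  have h0 : cuspCoeff f 0 = 0 := by rw [ha, ArithmeticFunction.map_zero, Int.cast_zero]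
  have hmul : ∀ m n : ℕ, m.Coprime n → cuspCoeff f (m * n) = cuspCoeff f m * cuspCoeff f n := by
    intro m n hmn
    rw [ha, ha, ha, V₀.isMultiplicative_LFunction.map_mul_of_coprime hmn, Int.cast_mul]
  have hrec : ∀ e : ℕ, cuspCoeff f (q ^ (e + 2)) =
      cuspCoeff f q * cuspCoeff f (q ^ (e + 1)) - q * cuspCoeff f (q ^ e) := by
    intro e
    rw [ha, ha, ha, ha, V₀.LFunction_apply_prime_pow_add_two_of_prime hqP e, if_neg hqN]
    push_cast; ring
  -- the eigencharacter and the ideal `𝔫 = ker(θ mod p)`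
  obtain ⟨θ, hθ, hθT⟩ := exists_eigenHom (M * q ^ 2) hf.1 (fun n ↦ V₀.LFunction n) ha
  set θp : HeckeRing0.primeTo M 2 (M * q ^ 2) →+* ZMod p := (Int.castRingHom (ZMod p)).comp θ with hθp
  set 𝔫 : Ideal (HeckeRing0.primeTo M 2 (M * q ^ 2)) := RingHom.ker θp with h𝔫
  have hmax : 𝔫.IsMaximal := RingHom.ker_isMaximal_of_surjective θp (ZMod.ringHom_surjective θp)
  have hmem : ∀ t, t ∈ 𝔫 ↔ ((θ t : ℤ) : ZMod p) = 0 := fun t ↦ by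
    rw [h𝔫, RingHom.mem_ker, hθp]; rfl
  have hnat : ∀ n : ℕ, ((n : HeckeRing0.primeTo M 2 (M * q ^ 2)) ∈ 𝔫) ↔ p ∣ n := fun n ↦ by
    rw [hmem, map_natCast, Int.cast_natCast, ZMod.natCast_eq_zero_iff]
  have h2 : (2 : HeckeRing0.primeTo M 2 (M * q ^ 2)) ∉ 𝔫 := by
    intro h
    have := (hnat 2).mp (by exact_mod_cast h)
    have := Nat.le_of_dvd two_pos this; omega
  have hq𝔫 : (q : HeckeRing0.primeTo M 2 (M * q ^ 2)) ∉ 𝔫 := fun h ↦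
    hqp ((Nat.prime_dvd_prime_iff_eq hpP hqP).mp ((hnat q).mp h)).symm
  have hNE' : ¬ HeckeRing0.primeTo.IsEisenstein 𝔫 := by
    obtain ⟨r, hr, hrS, hr1, hra⟩ := hNE
    intro hE
    have h1 := (hmem _).mp (hE r hr hrS hr1)
    rw [map_sub, map_add, map_natCast, map_one, hθT r hr hrS] at h1
    exact hra ((ZMod.intCast_zmod_eq_zero_iff_dvd _ p).mp h1)
  -- Ihara³
  obtain ⟨s₀, hs₀𝔫, hlift3⟩ := hI3 M q hqN hM3 𝔫 hmax h2 hq𝔫 hNE'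
  set u : ℤ := θ s₀ with hu
  have hpu : ¬ (p : ℤ) ∣ u := fun h ↦ hs₀𝔫 ((hmem s₀).mpr ((ZMod.intCast_zmod_eq_zero_iff_dvd u p).mpr h))
  have hlift : ∀ x ∈ periodHomology M, ∃ z ∈ periodHomology (M * q ^ 2),
      (degeneracyMap0 M (M * q ^ 2) 1 2).dualMap z = (s₀ : HeckeRing0 M 2) • x ∧
      (degeneracyMap0 M (M * q ^ 2) q 2).dualMap z = 0 ∧
      (degeneracyMap0 M (M * q ^ 2) (q ^ 2) 2).dualMap z = 0 := by
    intro x hx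
    obtain ⟨z', hz', h1, h2, h3⟩ := hlift3 x hx 0 (zero_mem _) 0 (zero_mem _)
    exact ⟨z', hz', h1, by rw [h2, smul_zero], by rw [h3, smul_zero]⟩
  -- the core
  obtain ⟨w, hw, y, hy, hzy⟩ := lTwist_core hq2 hqp hχ f h0 hmul hrec (s₀ : HeckeRing0 M 2) u hpu (hθ s₀)
    hlift s hs2 z hz
  -- identification of `g` with `f ⊗ χ` at level `M q²`
  set g' := charTwist (M * q ^ 2) (dvd_mul_right M (q ^ 2)) (dvd_mul_left (q ^ 2) M) hχ f with hg'def
  have hd0 : d ≠ 0 := by rw [hd]; exact mul_ne_zero (pow_ne_zero _ (by norm_num)) (by exact_mod_cast hqP.ne_zero)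
  have hgood : V₀.HasGoodReductionAtPrime q :=
    not_not.mp ((V₀.dvd_conductorNorm_iff_not_hasGoodReductionAtPrime q).not.mp hqN)
  have haddtw : ∀ w : IsDedekindDomain.HeightOneSpectrum (NumberField.RingOfIntegers ℚ),
      ((Rat.HeightOneSpectrum.primesEquiv w : ℕ) : ℤ) ∣ d →
      (V₀.quadraticTwist (d : ℚ)).HasAdditiveReductionAt w := by
    intro w hw
    have hℓ : (Rat.HeightOneSpectrum.primesEquiv w : ℕ) = q := by
      have h1 : (Rat.HeightOneSpectrum.primesEquiv w : ℕ) ∣ d.natAbs := Int.natCast_dvd.mp hw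
      rw [hdabs] at h1
      exact (Nat.prime_dvd_prime_iff_eq (Rat.HeightOneSpectrum.primesEquiv w).2 hqP).mp h1
    have hgood' : V₀.HasGoodReductionAt w := by
      have := (V₀.dvd_conductorNorm_iff w).not
      rw [hℓ] at this
      exact not_not.mp (this.mp hqN)
    refine V₀.hasAdditiveReductionAt_quadraticTwist_of_dvd w (by rw [hℓ]; exact hq2) hd0 hw ?_ hgood'
    rw [hℓ]
    intro h
    have h' : q ^ 2 ∣ d.natAbs := Int.natCast_dvd.mp (by exact_mod_cast h)
    rw [hdabs] at h'
    have := Nat.le_of_dvd hqP.pos h'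
    nlinarith [hqP.one_lt]
  have hd0q : ((d : ℤ) : ℚ) ≠ 0 := by exact_mod_cast hd0
  haveI : (V₀.quadraticTwist (d : ℚ)).IsElliptic := V₀.isElliptic_quadraticTwist hd0q
  have hg' : IsNewformOf Vχ g' := by
    refine ⟨isNewform0_charTwist_of_isPrimePow_of_coprime hχ hprim hqP.isPrimePow
      ((Nat.Prime.coprime_iff_not_dvd hqP).mpr hqN).symm hf.1, fun n ↦ ?_⟩
    rw [hg'def, cuspCoeff_charTwist _ _ _ hχ hprim f n, ha n, ← hv, WeierstrassCurve.LFunction_smul,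
      Summit.BirchSwinnertonDyer.Rank1Residual.Additive.lFunction_quadraticTwist_apply_of_hasAdditiveReductionAt
        V₀ hd4 hdsq haddtw n, hdabs, jacobiChar_natCast]
    push_cast; ring
  have hN' : N' = M * q ^ 2 := hg.level_eq_level hg'
  subst hN'
  have hgg' : g = g' := eq_of_forall_cuspCoeff_eq_gamma0 fun n ↦ by rw [hg.2 n, hg'.2 n]
  rw [hgg']
  exact ⟨w, hw, y, hy, hzy⟩

end Summit.BirchSwinnertonDyer.BirchSwinnertonDyer.Theorems.LTwist

end
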